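import Summits.BirchSwinnertonDyer.BirchSwinnertonDyer.Theorems.ThetaPartnerAtTwoSignedKatoUpToAtTwoLayerPoitouTateWeil
import Summits.BirchSwinnertonDyer.BirchSwinnertonDyer.Theorems.ThetaPartnerAtTwoSignedKatoUpToAtTwoLayerGlobalShapiro
import Summits.BirchSwinnertonDyer.BirchSwinnertonDyer.Theorems.ThetaPartnerAtTwoSignedKatoUpToAtTwoLayerPairingPk
import HarnessLib

/-!
# Route `ThetaPartnerAtTwo` (TP2), crux K3 `SignedKatoDivisibilityUpToAtTwo` (item stmt-BirchSwinnertonDyer-20308) /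
# K3P′ (item 25631), line `colemanrat` v8/v9 — S2 = (PT-orth) AT A FINITE LAYER AND LEVEL, `p`-GENERIC form

Width seat `bsd-wall-tp2-p2x-w2` g4 (cell `bsd-wall`), for the lead `bsd-wall-tp2-p2x` g5. HONEST FRAMING: THEOREMS ONLY (no definition,
no named fact, no instance, no `sorry`); closes no item; BSD is NOT proved by any of this. The registered stub `stub_ptOrthLayerTwo` (p = 2,
verbatim) is the LEAD's tree theorem `SignedKatoOffTwo.LayerPTFinal.stub_ptOrthLayerTwo` (`…LayerPTOrthFinal.lean`, p615870, same chain);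
this file records the `p`-GENERIC statement of the same assembly (the lead's S2 architecture is prime-independent: any prime `p`, the
cyclotomic `ℤ_p`-extension of `ℚ`, the unique place above `p`), for reuse by the odd-`p` signed lines.

## The assembly (the lead's S2 architecture, all pieces in the tree)
For the place `v ∋ p` of `ℚ`, the cyclotomic `ℤ_p`-extension `κ`, a compatible Weil family `e k : E[p^k] × E[p^k] → μ_{p^k}` (one-step
compatibility (WEIL)), a layer `N`, a level `L₀`, `x ∈ H¹(Γ_N, T_pE)`, a layer Selmer class `t ∈ Sel_{p^∞}(E/ℚ_N)` with a cocycle `φ_N`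
killed by `p^{L₀}` whose restriction to `U_N = Gal(ℚ̄_v/ℚ_N·ℚ_v)` is the Kummer cocycle `τ ↦ τQ' − Q'` of a point `Q'` with `p^{L₀}Q' ∈ E(ℚ_N·ℚ_v)`:

1. `φ_N` lifts to a cocycle `ψ₀ : Γ_N → E[p^{L₀}]` (`LayerFinite.exists_torsionCocycle_of_zsmul_eq_zero`, lead);
2. Poitou–Tate in the Shapiro model with the level transport discharged (w2, `LayerPTW2.two_nsmul_localInvariantMap_weilShapiroCup_eq_zero_of_step`
   = lead's T2 `LayerPT.two_nsmul_localInvariantMap_cup_shapiroLift_eq_zero` ∘ `Kato2004.shapiroCup_weil_htrans_reduceH1Pk`):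
   `2 • inv_v(loc_v(Sh(red_{p^{L₀}} x) ∪_{Σ e_{L₀}} Sh[ψ₀])) = 0`;
3. the localisation of `[ψ₀]` at the layer is the layer Kummer class of `Q = p^{L₀}Q'` (w3, `LayerPairing.layerKummer_eq_oneCocycleClass`);
4. one double coset at `v ∣ p`: `inv_v(loc_v(Sh a ∪_Σ Sh b)) = layerPairingMod … a Q` (w3, `LayerPairing.invAt_localization_cupProduct_shapiroLift_layer`);
5. `layerPairingPk … N L₀ x Q = layerPairingMod … (red_{p^{L₀}} x) Q` (w3, `LayerPairing.layerPairingPk_apply`).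

## What is proved
* `two_nsmul_layerPairingPk_eq_zero` — the `p`-generic statement: `2 • ⟨red_{p^{L₀}} x, p^{L₀}Q'⟩_{N,p^{L₀}} = 0` in `ℤ/p^{L₀}`
  (for odd `p` this is `⟨red_{p^{L₀}} x, p^{L₀}Q'⟩_{N,p^{L₀}} = 0`, `2` being a unit).

References: [Kobayashi2003] (7.16)–(7.21) (p. 12), (8.23) (p. 18); [Kato2004Asterisque] §13.8 (p. 228), §17.13 (p. 279);
[MilneADT2006] Ch. I Thm. 4.10 (b), Ex. 1.6 (c); [SilvermanAEC2009] Prop. III.8.1 (e), VIII §2.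
-/

set_option autoImplicit false
-- the Theorems namespace of this sub repeats the summit name by design (D-0017 nested layout)
set_option linter.dupNamespace false

noncomputable section

open scoped Classical ContRepresentation NumberField

namespace Summit.BirchSwinnertonDyer.BirchSwinnertonDyer.Theorems

namespace SignedKatoOffTwo

open CategoryTheory NumberField IsDedekindDomain Field ContinuousCohomology WeierstrassCurve
  Literature.NumberTheory.EllipticCurves Literature.NumberTheory.EllipticCurves.GreenbergSelmer
  Literature.NumberTheory.EllipticCurves.Kato2004 Literature.NumberTheory.EllipticCurves.Kato2004.EulerSystemValues
  Literature.NumberTheory.EllipticCurves.Kobayashi2003 Literature.NumberTheory.EllipticCurves.Sprung2012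
  Literature.NumberTheory.GaloisRepresentations Literature.NumberTheory.GaloisRepresentations.DiscreteGaloisModule
  Literature.NumberTheory.GaloisCohomology ZpExtension

/-- **(PT-orth) at a finite layer and level, `p`-generic.** For the place `v ∋ p`, `κ` cyclotomic, a Weil family `e` with the one-step
compatibility (WEIL), a layer `N`, a level `L₀`, `x ∈ H¹(Γ_N, T_pE)`, a layer Selmer class `t` with a cocycle `φ_N` killed by `p^{L₀}` whose
restriction to `U_N` is the Kummer cocycle of `Q'` (`p^{L₀} Q' ∈ E(ℚ_N·ℚ_v)`): the (D-layer) pairing value is `2`-torsion,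
`2 • layerPairingPk … N L₀ x ⟨p^{L₀} Q', _⟩ = 0`. (Steps 1–5 of the module docstring.)
[cite: Kobayashi2003, (7.16)–(7.21) (p. 12)] [cite: Kato2004Asterisque, §17.13 (p. 279)] [cite: MilneADT2006, Ch. I, Thm. 4.10(b)] -/
theorem two_nsmul_layerPairingPk_eq_zero {p : ℕ} [hp : Fact p.Prime]
    (v : HeightOneSpectrum (𝓞 ℚ)) (hv : ((p : ℕ) : 𝓞 ℚ) ∈ v.asIdeal)
    (W : WeierstrassCurve ℚ) [W.IsElliptic] [ContinuousSMul ℤ_[p] (W.tateModule p)]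
    (κ : ZpExtension ℚ p) (hκ : κ.IsCyclotomic)
    (e : ∀ k : ℕ, geomTorsion W ((p ^ k : ℕ) : ℤ) → geomTorsion W ((p ^ k : ℕ) : ℤ) → AlgebraicClosure ℚ)
    (hμ : ∀ (k : ℕ) S T, e k S T ^ (p ^ k) = 1)
    (hadd₁ : ∀ (k : ℕ) S₁ S₂ T, e k (S₁ + S₂) T = e k S₁ T * e k S₂ T)
    (hadd₂ : ∀ (k : ℕ) S T₁ T₂, e k S (T₁ + T₂) = e k S T₁ * e k S T₂)
    (hgal : ∀ (k : ℕ) (σ : absoluteGaloisGroup ℚ) (S T : geomTorsion W ((p ^ k : ℕ) : ℤ)), σ • e k S T = e k (σ • S) (σ • T))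
    (hstep : ∀ (k : ℕ) (S' : geomTorsion W ((p ^ (k + 1) : ℕ) : ℤ)) (S : geomTorsion W ((p ^ k : ℕ) : ℤ))
      (T' : geomTorsion W ((p ^ (k + 1) : ℕ) : ℤ)) (T : geomTorsion W ((p ^ k : ℕ) : ℤ)),
      (S : W.geomPoints) = (p : ℤ) • (S' : W.geomPoints) → (T' : W.geomPoints) = (T : W.geomPoints) →
      e (k + 1) S' T' = e k S T)
    (N L₀ : ℕ) (x : H1 (tateRep W p) (κ.layerSubgroup N))
    (t : W.subgroupH1 p (κ.layerSubgroup N)) (ht : t ∈ W.selmerLayer κ N)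
    (φN : contOneCocycles (discreteTopRep (κ.layerSubgroup N) (W.geomPrimaryTorsion p))) (hφN : oneCocycleClass _ φN = t)
    (hkill : ∀ y, (p ^ L₀ : ℕ) • ((φN.1 y : W.geomPrimaryTorsion p) : W.geomPoints) = 0)
    (Q' : localPoints W (v.adicCompletion ℚ))
    (hP' : (p ^ L₀ : ℕ) • Q' ∈ localLayerPointsOfEmb κ (closureEmb (K := ℚ) (v.adicCompletion ℚ)) W N)
    (hloc : ∀ τ : localSubgroupOfEmb (κ.layerSubgroup N) (closureEmb (K := ℚ) (v.adicCompletion ℚ)),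
      pointsMapOfEmb W (closureEmb (K := ℚ) (v.adicCompletion ℚ))
          ((φN.1 (resGalSubgroupOfEmb (κ.layerSubgroup N) _ τ) : W.geomPrimaryTorsion p) : W.geomPoints) =
        (τ : absoluteGaloisGroup (v.adicCompletion ℚ)) • Q' - Q') :
    2 • LayerPairing.layerPairingPk W κ v e hμ hadd₁ hadd₂ hgal N L₀ x ⟨(p ^ L₀ : ℕ) • Q', hP'⟩ = 0 := by
  haveI : CompactSpace (absoluteGaloisGroup ℚ) := absoluteGaloisGroup_compactSpace ℚ
  -- the finite quotient `Γ_ℚ ⧸ Γ_N` and a system of representatives with `s 1 = 1`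
  haveI : (κ.layerSubgroup N).FiniteIndex := finiteIndex_of_isOpen_of_compactSpace _ (κ.isOpen_layerSubgroup N)
  letI : Fintype (absoluteGaloisGroup ℚ ⧸ κ.layerSubgroup N) := Fintype.ofFinite _
  let s : absoluteGaloisGroup ℚ ⧸ κ.layerSubgroup N → absoluteGaloisGroup ℚ := Function.update Quotient.out 1 1
  have hs1 : s ((1 : absoluteGaloisGroup ℚ) : absoluteGaloisGroup ℚ ⧸ κ.layerSubgroup N) = 1 := by
    simp only [s, QuotientGroup.mk_one, Function.update_self]
  have hs : ∀ y, (s y : absoluteGaloisGroup ℚ ⧸ κ.layerSubgroup N) = y := fun y ↦ by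
    by_cases hy : y = 1
    · subst hy
      rw [← QuotientGroup.mk_one, hs1]
    · simp only [s, Function.update_of_ne hy]
      exact QuotientGroup.out_eq' y
  -- step 1: a lift `ψ₀ : Γ_N → E[p^{L₀}]` of `φ_N`
  obtain ⟨ψ₀, hψ₀⟩ := LayerFinite.exists_torsionCocycle_of_zsmul_eq_zero W p (κ.layerSubgroup N) ((p ^ L₀ : ℕ) : ℤ) φN
    fun y ↦ by rw [natCast_zsmul]; exact hkill y
  -- step 2: Poitou–Tate with the level transport discharged
  have hS2 := LayerPTW2.two_nsmul_localInvariantMap_weilShapiroCup_eq_zero_of_step W κ N hs hs1 v hv e hμ hadd₁ hadd₂ hgal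
    hstep L₀ x ht φN hφN hkill ψ₀ hψ₀
  -- step 3: the localisation of `[ψ₀]` at the layer is the layer Kummer class of `Q = p^{L₀} Q'`
  have hlocψ : LayerPairing.layerLoc W (p ^ L₀) κ v N (oneCocycleClass _ ψ₀) =
      oneCocycleClass _ (contOneCocycles.pullback
        (resGalSubgroupOfEmb (κ.layerSubgroup N) (closureEmb (K := ℚ) (v.adicCompletion ℚ)))
        (TopRep.ofHom ⟨ContinuousLinearMap.id ℤ (geomTorsion W (p ^ L₀)), fun _ => rfl⟩) ψ₀) :=
    map_oneCocycleClass _ _ _ ψ₀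
  have hb : LayerPairing.layerLoc W (p ^ L₀) κ v N (oneCocycleClass _ ψ₀) =
      LayerPairing.layerKummer W (p ^ L₀) κ v N ⟨(p ^ L₀ : ℕ) • Q', hP'⟩ := by
    rw [hlocψ]
    refine (LayerPairing.layerKummer_eq_oneCocycleClass W (p ^ L₀) κ v N ⟨(p ^ L₀ : ℕ) • Q', hP'⟩ Q'
      (by rw [natCast_zsmul]) _ fun τ ↦ ?_).symm
    -- the value of the pulled-back cocycle at `τ` is `ψ₀(τ)` (definitionally), whose image in `E(ℚ̄)` is `φ_N(τ)`
    exact (congrArg (pointsMapOfEmb W (closureEmb (K := ℚ) (v.adicCompletion ℚ)))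
      (hψ₀ (resGalSubgroupOfEmb (κ.layerSubgroup N) _ τ))).trans (hloc τ)
  -- step 4: one double coset at `v ∣ p`
  have hw3 := LayerPairing.invAt_localization_cupProduct_shapiroLift_layer W (p ^ L₀) (e L₀) (hμ L₀) (hadd₁ L₀) (hadd₂ L₀)
    (hgal L₀) κ v hκ hv N hs hs1 (reduceH1Pk W p L₀ (κ.layerSubgroup N) x) (oneCocycleClass _ ψ₀) ⟨(p ^ L₀ : ℕ) • Q', hP'⟩ hb
  -- step 5: `layerPairingPk = layerPairingMod ∘ red`, and `invAt = localInvariantMap`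
  have key : LayerPairing.layerPairingPk W κ v e hμ hadd₁ hadd₂ hgal N L₀ x ⟨(p ^ L₀ : ℕ) • Q', hP'⟩ =
      LayerPairing.invAt (p ^ L₀) v (galoisCohomology.localization (DiscreteGaloisModule.mu ℚ (p ^ L₀)) (Sum.inr v) 2
        (((weilContPairing W (p ^ L₀) (e L₀) (hμ L₀) (hadd₁ L₀) (hadd₂ L₀) (hgal L₀)).coindFin (κ.layerSubgroup N)).cupProduct
          (shapiroLift (W.torsionGaloisModule ((p ^ L₀ : ℕ) : ℤ)).toTopRep (κ.layerSubgroup N) (κ.isOpen_layerSubgroup N) hs hs1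
            (reduceH1Pk W p L₀ (κ.layerSubgroup N) x))
          (shapiroLift (W.torsionGaloisModule ((p ^ L₀ : ℕ) : ℤ)).toTopRep (κ.layerSubgroup N) (κ.isOpen_layerSubgroup N) hs hs1
            (oneCocycleClass _ ψ₀)))) := by
    rw [LayerPairing.layerPairingPk_apply]
    exact hw3.symm
  rw [key]
  exact hS2

end SignedKatoOffTwo

end Summit.BirchSwinnertonDyer.BirchSwinnertonDyer.Theorems

end
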